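import Literature.NumberTheory.Automorphic.UnitaryGroupAdelicOneTorusDictionary
import HarnessLib

/-!
# D5 · One-dimensional automorphic representations `ξ = (η ∘ det₀) · (ψ ∘ det)` of the endoscopic group
# `H = U(2) × U(1)` over a CM field (Rogawski 1990, §12.2–§12.3, §13.1), in the torus-dictionary currency

CM frame: `L` a CM field, `L⁺ = maximalRealSubfield L`, `c̄ = IsCMField.complexConj L`; the adelic points of the norm-one torus
`T = U(1)_{L/L⁺}` are ★ `TorusDict.torus c̄ ≤ 𝕀_L` (= ★ `UnitaryGroup.adelicOne L⁺ L c̄`, `UnitaryGroupAdelicOneTorusDictionary`).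

A one-dimensional representation of `H(𝔸_{L⁺}) = U(2)(𝔸) × U(1)(𝔸)` is `ξ(h) = η(det₀ h) · ψ(det h)` for two characters `η, ψ` of
`T(𝔸_{L⁺})` ([Rogawski1990, §12.2 p. 174: `ξ(h) = η′(det₀(h)) χ₂(det(h))`]; automorphic iff `η, ψ` are trivial on `T(L⁺)`).
This file records `ξ` as the STRUCTURE `OneDimAutRepH L` (typ3 round-2 item **D5** of the F0∕P3 programme, cell `hodgecm-mathlib`,
crux H413; F0P3-plan (g3) RULINGS (M1), (N3), (P1); p04 (g4) memo `TYP3-SIGNATURES-D5D6` §1):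

* DATA: the two continuous characters `η ψ : ↥(TorusDict.torus c̄) →ₜ* ℂˣ`;
* PROPS ONLY (ruling (P1) — no archimedean integers as data, so that `ξ = ξ′ ↔ (ξ.η = ξ′.η ∧ ξ.ψ = ξ′.ψ)`, `OneDimAutRepH.ext`):
  automorphy `hη hψ` (★ `TorusDict.IsAutomorphic`) and the EXISTENCE of an archimedean type of the base changes
  `η̃ = η ∘ (z ↦ c̄ • z / z)`, `ψ̃` (★ `TorusDict.pullback`): `harchη : ∃ e, η̃.HasUnitaryArchType (2e) 0`, `harchψ` — by ★ §45.7
  `TorusDict.hasUnitaryArchType_pullback_iff` this says `η_∞ (u_w)_w = ∏_w ι_w(u_w)^{−e_w}` on `T(L⁺ ⊗ ℝ) = ∏_{v∣∞} U(1)`;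
* DERIVED: unitarity `unit_η`∕`unit_ψ` (★ `UnitaryGroup.norm_torusHom_apply_eq_one_of_isAutomorphic` — automorphic characters of the
  anisotropic torus are unitary, so NOT a field), the base changes `bcη`∕`bcψ : HeckeCharacter L`, the archimedean types
  `eη`∕`eψ := Classical.choose harchη∕harchψ` with `hasUnitaryArchType_bcη`∕`_bcψ` and the torus-side reading `η_arch_apply`∕`ψ_arch_apply`,
  and the EMBEDDING-indexed exponents `expAt e ι` (`= −e_w` if `ι = σ_w` is Mathlib's embedding of `w = mk ι`, `= +e_w` if `ι = σ̄_w`;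
  `expAt_conjugate`): `pη ξ ι`, `qψ ξ ι` = the integers `p, q` with `η_ι(u) = u^p`, `ψ_ι(u) = u^q` on `U(1) ⊂ ℂ` read through `ι`
  (the currency of the archimedean sign recipe, [Rogawski1990, §12.3 p. 178], F0P3-p03 (g5) `ArchSignRecipe`).

NOT here: an ABSOLUTE Hodge sign (RULING (Q): the sign letter R♭ is relative; §5 is Rogawski's own `J^±_φ` label only), the local
components `ξ_v` at finite places (T-loc, F0P3-p01 (g5)), `ξ` as a function on an `H(𝔸)` carrier (★ `UnitaryGroup.adelicDet`), D6
`MemAPacket` and the global facts (director-gated).  No instance, no notation, no named fact (debt 0).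

## References
[Rogawski1990] §12.2 pp. 173–174 (`ξ(h) = η′(det₀ h) χ₂(det h)`), §12.3 pp. 174–178 (`E/F = ℂ/ℝ`: `μ(z) = (z/z̄)^{t+1/2}`,
`ξ(h) = det₀(h)^{−m−t−1} det(h)^a` ∕ `det₀(h)^{n−t} det(h)^c`), §13.1 p. 199 (one-dimensional automorphic `ξ` of `H`, the packets
`Π(ξ)`); [Godement1964] §5 Thm. 4 (automorphic ⇒ unitary on an anisotropic torus); [Arthur2011Draft] d-p.303 ∕ d-p.319 (archimedean
type `(2e, 0)` of the base change).
HC_CM is proved only modulo the printed citations until rung 0 closes. -/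

set_option autoImplicit false

noncomputable section

namespace Literature.NumberTheory.Rogawski1990

open NumberField Literature.NumberTheory.Automorphic Literature.NumberTheory.GaloisRepresentations
open Literature.NumberTheory.Automorphic.Arthur2013.Leaves.TECR
open scoped Classical

/-- **A one-dimensional automorphic representation `ξ = (η ∘ det₀) · (ψ ∘ det)` of `H(𝔸_{L⁺}) = U(2) × U(1)`** over the CM
field `L`, recorded by its pair of automorphic characters `η, ψ` of the norm-one torus `T(𝔸_{L⁺}) = U(1)_{L/L⁺}(𝔸)` (★ `TorusDict.torus`)
together with the EXISTENCE of an (even, unitary) archimedean type of their base changes `η̃ = η ∘ (z ↦ z̄/z)`, `ψ̃`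
(★ `TorusDict.pullback`, ★ `HeckeCharacter.HasUnitaryArchType`; «type `(2e, 0)`» = «`η_∞ = (u_w)_w ↦ ∏_w ι_w(u_w)^{−e_w}`», ★ §45.7).
«let `ξ` be a one-dimensional automorphic representation of `H`», `ξ(h) = η′(det₀(h)) χ₂(det(h))`.
[cite: Rogawski1990, §12.2 p. 174; §13.1 p. 199] -/
structure OneDimAutRepH (L : Type) [Field L] [NumberField L] [IsCMField L] where
  /-- the `det₀`-character `η` (a continuous character of `T(𝔸_{L⁺})`) -/
  η : ↥(TorusDict.torus (IsCMField.complexConj L)) →ₜ* ℂˣ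
  /-- the `det`-character `ψ` -/
  ψ : ↥(TorusDict.torus (IsCMField.complexConj L)) →ₜ* ℂˣ
  /-- `η` is automorphic: trivial on `T(L⁺) = T(𝔸) ∩ L^×` -/
  hη : TorusDict.IsAutomorphic (IsCMField.complexConj L) η
  /-- `ψ` is automorphic -/
  hψ : TorusDict.IsAutomorphic (IsCMField.complexConj L) ψ
  /-- `η̃` has SOME archimedean type `(2e, 0)` (i.e. `η_∞(u) = ∏_w ι_w(u_w)^{−e_w}` for some integers `e_w`) -/
  harchη : ∃ e : InfinitePlace L → ℤ,
    (TorusDict.pullback (IsCMField.complexConj L) (Algebra.IsQuadraticExtension.finrank_eq_two _ L)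
      (IsCMField.complexConj_ne_one (K := L)) η hη).HasUnitaryArchType (fun w => 2 * e w) (fun _ => 0)
  /-- `ψ̃` has SOME archimedean type `(2e, 0)` -/
  harchψ : ∃ e : InfinitePlace L → ℤ,
    (TorusDict.pullback (IsCMField.complexConj L) (Algebra.IsQuadraticExtension.finrank_eq_two _ L)
      (IsCMField.complexConj_ne_one (K := L)) ψ hψ).HasUnitaryArchType (fun w => 2 * e w) (fun _ => 0)

namespace OneDimAutRepH

variable {L : Type} [Field L] [NumberField L] [IsCMField L]

/-! ## §1 Extensionality: `ξ` is determined by `(η, ψ)` -/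

/-- **`ξ = ξ′` as soon as the two characters agree** (the remaining fields are propositions — ruling (P1): the labels of the
rung-3 S-layer are not over-parametrised, so S3♭'s conclusion `ξ = ξ′` is the equality of the two automorphic characters).
[cite: Rogawski1990, §13.1 p. 199] -/
@[ext]
theorem ext {ξ ξ' : OneDimAutRepH L} (hη : ξ.η = ξ'.η) (hψ : ξ.ψ = ξ'.ψ) : ξ = ξ' := by
  cases ξ
  cases ξ'
  cases hη
  cases hψ
  rfl

/-- `ξ = ξ′ ↔ ξ.η = ξ′.η ∧ ξ.ψ = ξ′.ψ`. [cite: Rogawski1990, §13.1 p. 199] -/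
theorem ext_iff' {ξ ξ' : OneDimAutRepH L} : ξ = ξ' ↔ ξ.η = ξ'.η ∧ ξ.ψ = ξ'.ψ :=
  ⟨fun h => by subst h; exact ⟨rfl, rfl⟩, fun h => ext h.1 h.2⟩

/-- **The trivial one-dimensional representation `ξ = 1` of `H(𝔸)`** (`η = ψ = 1`, archimedean types `0`): the structure is
inhabited (non-vacuity witness for the junk audit). [cite: Rogawski1990, §13.1 p. 199] -/
def trivial : OneDimAutRepH L where
  η := 1
  ψ := 1
  hη := fun _ _ => rfl
  hψ := fun _ _ => rfl
  harchη := ⟨0, fun x => by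
    simp [TorusDict.pullback_apply, archUnitaryValue]⟩
  harchψ := ⟨0, fun x => by
    simp [TorusDict.pullback_apply, archUnitaryValue]⟩

/-- `OneDimAutRepH L` is non-empty. [cite: Rogawski1990, §13.1 p. 199] -/
theorem nonempty : Nonempty (OneDimAutRepH L) := ⟨trivial⟩

/-! ## §2 Unitarity (derived) and the base changes `η̃`, `ψ̃` -/

/-- **`η` is unitary**: `‖η t‖ = 1` — an automorphic continuous character of the anisotropic torus `T(𝔸_{L⁺})` takes values in `ℂ¹`
(★ `UnitaryGroup.norm_torusHom_apply_eq_one_of_isAutomorphic`: it descends to the compact quotient `T(L⁺)\T(𝔸_{L⁺})`).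
[cite: Godement1964, §5 Thm. 4] -/
theorem unit_η (ξ : OneDimAutRepH L) (t : ↥(TorusDict.torus (IsCMField.complexConj L))) : ‖((ξ.η t : ℂˣ) : ℂ)‖ = 1 :=
  UnitaryGroup.norm_torusHom_apply_eq_one_of_isAutomorphic _ L _ (Algebra.IsQuadraticExtension.finrank_eq_two _ L)
    (IsCMField.complexConj_ne_one (K := L)) ξ.η ξ.hη t

/-- **`ψ` is unitary**: `‖ψ t‖ = 1`. [cite: Godement1964, §5 Thm. 4] -/
theorem unit_ψ (ξ : OneDimAutRepH L) (t : ↥(TorusDict.torus (IsCMField.complexConj L))) : ‖((ξ.ψ t : ℂˣ) : ℂ)‖ = 1 :=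
  UnitaryGroup.norm_torusHom_apply_eq_one_of_isAutomorphic _ L _ (Algebra.IsQuadraticExtension.finrank_eq_two _ L)
    (IsCMField.complexConj_ne_one (K := L)) ξ.ψ ξ.hψ t

/-- **The base change `η̃ = η ∘ (z ↦ c̄ • z / z)`**, a Hecke character of `L` (★ `TorusDict.pullback`). «`η′(a/ā) = …`».
[cite: Rogawski1990, §12.2 p. 174] -/
def bcη (ξ : OneDimAutRepH L) : HeckeCharacter L :=
  TorusDict.pullback (IsCMField.complexConj L) (Algebra.IsQuadraticExtension.finrank_eq_two _ L)
    (IsCMField.complexConj_ne_one (K := L)) ξ.η ξ.hη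

/-- **The base change `ψ̃ = ψ ∘ (z ↦ c̄ • z / z)`**, a Hecke character of `L`. [cite: Rogawski1990, §12.2 p. 174] -/
def bcψ (ξ : OneDimAutRepH L) : HeckeCharacter L :=
  TorusDict.pullback (IsCMField.complexConj L) (Algebra.IsQuadraticExtension.finrank_eq_two _ L)
    (IsCMField.complexConj_ne_one (K := L)) ξ.ψ ξ.hψ

/-- `η̃ z = η (c̄ • z / z)` (★ `TorusDict.pullback_apply`). [cite: Rogawski1990, §12.2 p. 174] -/
theorem bcη_apply (ξ : OneDimAutRepH L) (z : ideleGroup L) :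
    ξ.bcη z = ξ.η (TorusDict.twistToTorus (IsCMField.complexConj L) (Algebra.IsQuadraticExtension.finrank_eq_two _ L)
      (IsCMField.complexConj_ne_one (K := L)) z) := rfl

/-- `ψ̃ z = ψ (c̄ • z / z)`. [cite: Rogawski1990, §12.2 p. 174] -/
theorem bcψ_apply (ξ : OneDimAutRepH L) (z : ideleGroup L) :
    ξ.bcψ z = ξ.ψ (TorusDict.twistToTorus (IsCMField.complexConj L) (Algebra.IsQuadraticExtension.finrank_eq_two _ L)
      (IsCMField.complexConj_ne_one (K := L)) z) := rfl

/-- `η̃` is trivial on the idèles of `L⁺` (★ `TorusDict.pullback_ideleBaseChange`). [cite: Rogawski1990, §12.2 p. 174] -/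
theorem bcη_ideleBaseChange (ξ : OneDimAutRepH L) (a : ideleGroup ↥(maximalRealSubfield L)) :
    ξ.bcη (AdeleRing.ideleBaseChange ↥(maximalRealSubfield L) L a) = 1 :=
  TorusDict.pullback_ideleBaseChange _ _ _ ξ.η ξ.hη a

/-- `ψ̃` is trivial on the idèles of `L⁺`. [cite: Rogawski1990, §12.2 p. 174] -/
theorem bcψ_ideleBaseChange (ξ : OneDimAutRepH L) (a : ideleGroup ↥(maximalRealSubfield L)) :
    ξ.bcψ (AdeleRing.ideleBaseChange ↥(maximalRealSubfield L) L a) = 1 :=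
  TorusDict.pullback_ideleBaseChange _ _ _ ξ.ψ ξ.hψ a

/-! ## §3 The archimedean types `eη`, `eψ` (chosen witnesses) and their reading on `T(L⁺ ⊗ ℝ) = ∏_{v∣∞} U(1)` -/

/-- **An archimedean type of `η̃`**: integers `e_w` with `η̃` of unitary type `(2e_w, 0)` (a CHOICE of the witness of `harchη`;
all consumers go through `hasUnitaryArchType_bcη` ∕ `η_arch_apply`). [cite: Arthur2011Draft, d-p.303 (§6.1), d-p.319 (§6.2 Remark 2)] -/
def eη (ξ : OneDimAutRepH L) : InfinitePlace L → ℤ := Classical.choose ξ.harchη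

/-- **An archimedean type of `ψ̃`** (chosen witness of `harchψ`). [cite: Arthur2011Draft, d-p.303 (§6.1), d-p.319 (§6.2 Remark 2)] -/
def eψ (ξ : OneDimAutRepH L) : InfinitePlace L → ℤ := Classical.choose ξ.harchψ

/-- `η̃` has unitary archimedean type `(2 eη, 0)`. [cite: Arthur2011Draft, d-p.303 (§6.1), d-p.319 (§6.2 Remark 2)] -/
theorem hasUnitaryArchType_bcη (ξ : OneDimAutRepH L) : ξ.bcη.HasUnitaryArchType (fun w => 2 * ξ.eη w) (fun _ => 0) :=
  Classical.choose_spec ξ.harchη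

/-- `ψ̃` has unitary archimedean type `(2 eψ, 0)`. [cite: Arthur2011Draft, d-p.303 (§6.1), d-p.319 (§6.2 Remark 2)] -/
theorem hasUnitaryArchType_bcψ (ξ : OneDimAutRepH L) : ξ.bcψ.HasUnitaryArchType (fun w => 2 * ξ.eψ w) (fun _ => 0) :=
  Classical.choose_spec ξ.harchψ

/-- **`η` on the archimedean torus**: for an archimedean idèle `(ζ, 1) ∈ T(𝔸_{L⁺})` (`ζ_w ζ̄_w = 1`),
`η(ζ, 1) = ∏_w ι_w(ζ_w)^{−eη w}` — the archimedean components of `η` are the characters `u ↦ u^{−eη w}` of `U(1)` read through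
Mathlib's embeddings `ι_w` (★ §45.7 `TorusDict.hasUnitaryArchType_pullback_iff`, CM situation).
[cite: Arthur2011Draft, d-p.319 (§6.2 Remark 2)] -/
theorem η_arch_apply (ξ : OneDimAutRepH L) (ζ : (InfiniteAdeleRing L)ˣ)
    (hζ : infiniteIdeles L ζ ∈ TorusDict.torus (IsCMField.complexConj L)) :
    ((ξ.η ⟨infiniteIdeles L ζ, hζ⟩ : ℂˣ) : ℂ) =
      ∏ w : InfinitePlace L, (InfinitePlace.Completion.extensionEmbedding w ((ζ : InfiniteAdeleRing L) w)) ^ (-ξ.eη w) :=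
  (TorusDict.hasUnitaryArchType_pullback_iff (IsCMField.complexConj L) (Algebra.IsQuadraticExtension.finrank_eq_two _ L)
    (IsCMField.complexConj_ne_one (K := L)) inferInstance inferInstance ξ.eη ξ.η ξ.hη).1 ξ.hasUnitaryArchType_bcη ζ hζ

/-- **`ψ` on the archimedean torus**: `ψ(ζ, 1) = ∏_w ι_w(ζ_w)^{−eψ w}`. [cite: Arthur2011Draft, d-p.319 (§6.2 Remark 2)] -/
theorem ψ_arch_apply (ξ : OneDimAutRepH L) (ζ : (InfiniteAdeleRing L)ˣ)
    (hζ : infiniteIdeles L ζ ∈ TorusDict.torus (IsCMField.complexConj L)) :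
    ((ξ.ψ ⟨infiniteIdeles L ζ, hζ⟩ : ℂˣ) : ℂ) =
      ∏ w : InfinitePlace L, (InfinitePlace.Completion.extensionEmbedding w ((ζ : InfiniteAdeleRing L) w)) ^ (-ξ.eψ w) :=
  (TorusDict.hasUnitaryArchType_pullback_iff (IsCMField.complexConj L) (Algebra.IsQuadraticExtension.finrank_eq_two _ L)
    (IsCMField.complexConj_ne_one (K := L)) inferInstance inferInstance ξ.eψ ξ.ψ ξ.hψ).1 ξ.hasUnitaryArchType_bcψ ζ hζ

/-! ## §4 Exponents at a complex EMBEDDING `ι : L →+* ℂ` (the currency of the archimedean recipe [§12.3 p. 178]) -/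

/-- **The exponent at the embedding `ι` of a place-indexed even type `e`**: the archimedean component at `w = mk ι` is the character
`u ↦ ι_w(u)^{−e_w}` of `U(1)` for Mathlib's embedding `ι_w = w.embedding`; read through `ι` itself it is `u ↦ ι(u)^{expAt e ι}` with
`expAt e ι = −e_w` if `ι = ι_w` and `= +e_w` if `ι = ῑ_w` (on `U(1)`, `ῑ(u) = ι(u)⁻¹`).  Pure bookkeeping of the pair `{ι, ῑ}` over `w`
(cf. ★ `HeckeCharacter.embExponent`). [cite: Rogawski1990, §12.3 p. 174] -/
def expAt (e : InfinitePlace L → ℤ) (ι : L →+* ℂ) : ℤ :=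
  if ι = (InfinitePlace.mk ι).embedding then -e (InfinitePlace.mk ι) else e (InfinitePlace.mk ι)

/-- A complex embedding of the (totally complex) CM field `L` is not real: `ῑ ≠ ι`. [cite: Rogawski1990, §12.3 p. 174] -/
theorem conjugate_ne_self (ι : L →+* ℂ) : ComplexEmbedding.conjugate ι ≠ ι := fun h =>
  InfinitePlace.not_isReal_iff_isComplex.mpr (IsTotallyComplex.isComplex (InfinitePlace.mk ι))
    (InfinitePlace.isReal_mk_iff.mpr (ComplexEmbedding.isReal_iff.mpr h))

omit [NumberField L] [IsCMField L] in
/-- At Mathlib's chosen embedding of a place: `expAt e σ_w = −e_w`. [cite: Rogawski1990, §12.3 p. 174] -/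
theorem expAt_embedding (e : InfinitePlace L → ℤ) (w : InfinitePlace L) : expAt e w.embedding = -e w := by
  simp only [expAt, InfinitePlace.mk_embedding, if_true]

/-- At the conjugate of Mathlib's chosen embedding (a complex place): `expAt e σ̄_w = +e_w`. [cite: Rogawski1990, §12.3 p. 174] -/
theorem expAt_conjugate_embedding (e : InfinitePlace L → ℤ) (w : InfinitePlace L) :
    expAt e (ComplexEmbedding.conjugate w.embedding) = e w := by
  simp only [expAt, InfinitePlace.mk_conjugate_eq, InfinitePlace.mk_embedding, if_neg (conjugate_ne_self w.embedding)]

/-- **Conjugating the embedding negates the exponent**: `expAt e ῑ = −expAt e ι` (`L` is totally complex, so `ῑ ≠ ι`, both over the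
same place). This is the bookkeeping behind «the conjugate identification `E_v = ℂ` replaces `(p, q, t)` by `(−p, −q, −t−1)`».
[cite: Rogawski1990, §12.3 p. 174] -/
theorem expAt_conjugate (e : InfinitePlace L → ℤ) (ι : L →+* ℂ) :
    expAt e (ComplexEmbedding.conjugate ι) = -expAt e ι := by
  simp only [expAt, InfinitePlace.mk_conjugate_eq]
  rcases InfinitePlace.embedding_mk_eq ι with h | h
  · -- `σ_w = ι`
    rw [if_neg (fun h' => conjugate_ne_self ι (h'.trans h)), if_pos h.symm, neg_neg]
  · -- `σ_w = ῑ`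
    rw [if_pos h.symm, if_neg (fun h' => conjugate_ne_self ι (h'.trans h).symm)]

/-- **`p = pη ξ ι`**: the exponent of `η` at `ι`, `η_ι(u) = ι(u)^p` on `U(1)(L⁺_v) ⊂ L_w^×` (`w = mk ι`).
[cite: Rogawski1990, §12.3 p. 178] -/
def pη (ξ : OneDimAutRepH L) (ι : L →+* ℂ) : ℤ := expAt ξ.eη ι

/-- **`q = qψ ξ ι`**: the exponent of `ψ` at `ι`, `ψ_ι(u) = ι(u)^q`. [cite: Rogawski1990, §12.3 p. 178] -/
def qψ (ξ : OneDimAutRepH L) (ι : L →+* ℂ) : ℤ := expAt ξ.eψ ι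

/-- `pη` under conjugation of the embedding: `p ↦ −p`. [cite: Rogawski1990, §12.3 p. 174] -/
theorem pη_conjugate (ξ : OneDimAutRepH L) (ι : L →+* ℂ) : ξ.pη (ComplexEmbedding.conjugate ι) = -ξ.pη ι :=
  expAt_conjugate ξ.eη ι

/-- `qψ` under conjugation of the embedding: `q ↦ −q`. [cite: Rogawski1990, §12.3 p. 174] -/
theorem qψ_conjugate (ξ : OneDimAutRepH L) (ι : L →+* ℂ) : ξ.qψ (ComplexEmbedding.conjugate ι) = -ξ.qψ ι :=
  expAt_conjugate ξ.eψ ι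

end OneDimAutRepH

/-! ## §5 Rogawski's archimedean LABEL of the non-tempered member `πⁿ(ξ_ι) ∈ {J⁺_φ, J⁻_φ}` as pure `ℤ`-arithmetic
(F0P3-p03 (g5)'s recipe `F0/P3/p03/ArchSignRecipe.F0P3p03g5.lean` §1–§3, 3c0ac5d2257de1b7, inserted VERBATIM up to the removal of
the two `Decidable` instances — the `if`s test `p + t ≤ −1` directly; ENGINE DOCUMENTATION API only: by F0P3-plan (g3) RULING (Q) no
statement of the rung-3 line asserts an ABSOLUTE Hodge sign, the sign letter R♭ is RELATIVE, and nothing below identifies Rogawski's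
label `J⁺_φ` with a Hodge type)

The three integers at `ι` (all w.r.t. the identification `L_w = ℂ` given by `ι`; conjugation acts by `(p, q, t) ↦ (−p, −q, −t−1)`):
`η_ι(u) = u^p`, `ψ_ι(u) = u^q` (`p = ξ.pη ι`, `q = ξ.qψ ι`, §4) and Rogawski's auxiliary Hecke character `μ` (`μ|_{𝕀_{L⁺}} = ω_{L/L⁺}`)
with `μ_ι(z) = (z/z̄)^{t+1/2}` [§12.3 p. 174] — `t` is a PARAMETER here (it is a datum of the packet labelling, not of `ξ`). -/

namespace ArchSignRecipe

/-- The `+` case of [Rogawski1990, §12.3 p. 178]: `ξ_ι = ξ(b,a,c)` with `n = b − c = 1` (then `πⁿ(ξ_ι) = J⁺_φ`); in exponents: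
`m = a − b = −p − t − 1 ≥ 0`. [cite: Rogawski1990, §12.3 p. 178] -/
def IsPlusCase (p t : ℤ) : Prop := p + t ≤ -1

/-- Unfolding of `IsPlusCase`. [cite: Rogawski1990, §12.3 p. 178] -/
theorem isPlusCase_iff (p t : ℤ) : IsPlusCase p t ↔ p + t ≤ -1 := Iff.rfl

/-- Rogawski's triple `(a, b, c)` (`a ≥ b ≥ c`) attached to `ξ_ι = (p, q; t)`: `(q, q+p+t+1, q+p+t)` in the `+` case,
`(q+p+t+1, q+p+t, q)` in the `−` case. [cite: Rogawski1990, §12.3 p. 178] -/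
def rogTriple (p q t : ℤ) : ℤ × ℤ × ℤ :=
  if p + t ≤ -1 then (q, q + p + t + 1, q + p + t) else (q + p + t + 1, q + p + t, q)

/-- The triple is weakly decreasing: `a ≥ b ≥ c`. [cite: Rogawski1990, §12.3 p. 178] -/
theorem rogTriple_antitone (p q t : ℤ) :
    (rogTriple p q t).2.2 ≤ (rogTriple p q t).2.1 ∧ (rogTriple p q t).2.1 ≤ (rogTriple p q t).1 := by
  unfold rogTriple
  split_ifs with h <;> simp only <;> constructor <;> omega

/-- `+` case: `n = b − c = 1`, and Rogawski's exponents `p = −m − t − 1`, `q = a` (`m = a − b`) are recovered: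
«`ξ(h) = det₀(h)^{−m−t−1} det(h)^a` if `ξ = ξ(b, a, c)`». [cite: Rogawski1990, §12.3 p. 178] -/
theorem rogTriple_plus_spec {p q t : ℤ} (h : IsPlusCase p t) :
    (rogTriple p q t).2.1 - (rogTriple p q t).2.2 = 1 ∧
      p = -((rogTriple p q t).1 - (rogTriple p q t).2.1) - t - 1 ∧ q = (rogTriple p q t).1 := by
  unfold rogTriple
  unfold IsPlusCase at h
  rw [if_pos h]
  refine ⟨?_, ?_, ?_⟩ <;> simp only <;> omega

/-- `−` case: `m = a − b = 1`, and Rogawski's exponents `p = n − t`, `q = c` (`n = b − c`) are recovered: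
«`ξ(h) = det₀(h)^{n−t} det(h)^c` if `ξ = ξ(a, c, b)`». [cite: Rogawski1990, §12.3 p. 178] -/
theorem rogTriple_minus_spec {p q t : ℤ} (h : ¬ IsPlusCase p t) :
    (rogTriple p q t).1 - (rogTriple p q t).2.1 = 1 ∧
      p = ((rogTriple p q t).2.1 - (rogTriple p q t).2.2) - t ∧ q = (rogTriple p q t).2.2 := by
  unfold rogTriple
  unfold IsPlusCase at h
  rw [if_neg h]
  refine ⟨?_, ?_, ?_⟩ <;> simp only <;> omega

/-- UNIQUENESS, `+` half: any presentation `ξ_ι = ξ(b,a,c)` with `a ≥ b`, `b − c = 1`, `p = −(a−b) − t − 1`, `q = a` forces the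
`+` case and the triple («unique integers `a ≥ b ≥ c` such that either … or …»). [cite: Rogawski1990, §12.3 p. 178] -/
theorem plus_repr_unique {p q t a b c : ℤ} (hab : b ≤ a) (hn : b - c = 1) (hp : p = -(a - b) - t - 1) (hq : q = a) :
    IsPlusCase p t ∧ rogTriple p q t = (a, b, c) := by
  have h : p + t ≤ -1 := by omega
  refine ⟨h, ?_⟩
  unfold rogTriple
  rw [if_pos h]
  ext <;> simp only <;> omega

/-- UNIQUENESS, `−` half: any presentation `ξ_ι = ξ(a,c,b)` with `b ≥ c`, `a − b = 1`, `p = (b−c) − t`, `q = c` forces the `−`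
case and the triple. [cite: Rogawski1990, §12.3 p. 178] -/
theorem minus_repr_unique {p q t a b c : ℤ} (hbc : c ≤ b) (hm : a - b = 1) (hp : p = (b - c) - t) (hq : q = c) :
    ¬ IsPlusCase p t ∧ rogTriple p q t = (a, b, c) := by
  have h : ¬ p + t ≤ -1 := by omega
  refine ⟨h, ?_⟩
  unfold rogTriple
  rw [if_neg h]
  ext <;> simp only <;> omega

/-- **Rogawski's label**: `rogSign p t = +1` if `πⁿ(ξ_ι) = J⁺_φ` (`+` case), `−1` if `πⁿ(ξ_ι) = J⁻_φ` (`−` case) — the labels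
`J^±_φ` are ROGAWSKI's (Langlands quotients of `i_G(χ^±_φ)`), NOT Hodge types. [cite: Rogawski1990, §12.3 p. 178] -/
def rogSign (p t : ℤ) : ℤ := if p + t ≤ -1 then 1 else -1

/-- The label is `±1` — unconditionally (every one-dimensional `ξ_ι` has a non-tempered partner `πⁿ(ξ_ι) ∈ {J⁺_φ, J⁻_φ}`).
[cite: Rogawski1990, §12.3 p. 178] -/
theorem rogSign_eq_one_or_eq_neg_one (p t : ℤ) : rogSign p t = 1 ∨ rogSign p t = -1 := by
  unfold rogSign; split_ifs <;> simp

/-- The label FLIPS under the conjugate identification `L_w = ℂ` (`(p, t) ↦ (−p, −t−1)`), as `J⁺_φ ↔ J⁻_φ` do.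
[cite: Rogawski1990, §12.3 p. 178] -/
theorem rogSign_conj (p t : ℤ) : rogSign (-p) (-t - 1) = -rogSign p t := by
  unfold rogSign
  split_ifs with h1 h2 h2 <;> omega

/-- `ξ_ι` is of COHOMOLOGICAL type for trivial coefficients: `φ(a,b,c) = φ(1,0,−1)` (so that `J^±_φ` have `H¹ ≠ 0`, Prop. 15.2.1 (b);
`F_φ` trivial ⇔ its highest weight `α^{a−1} β^b γ^{c+1}` is trivial). [cite: Rogawski1990, Prop. 15.2.1 (b); §12.3 p. 176] -/
def IsCohTrivial (p q t : ℤ) : Prop := rogTriple p q t = (1, 0, -1)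

/-- The cohomological-weight condition in exponents: `(q, p + t) = (1, −2)` (`+` case, `m = n = 1`) or `(q, p + t) = (−1, 1)`
(`−` case, `m = n = 1`). [cite: Rogawski1990, §12.3 p. 178; Prop. 15.2.1 (b)] -/
theorem isCohTrivial_iff (p q t : ℤ) : IsCohTrivial p q t ↔ (q = 1 ∧ p + t = -2) ∨ (q = -1 ∧ p + t = 1) := by
  unfold IsCohTrivial rogTriple
  split_ifs with h <;> simp only [Prod.mk.injEq] <;> omega

/-- **Under the cohomological-weight condition Rogawski's label is `q`** (the `ι`-exponent of the `det`-character `ψ`), independent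
of `η` and of `μ`. [cite: Rogawski1990, §12.3 p. 178; Prop. 15.2.1 (b)] -/
theorem rogSign_eq_of_isCohTrivial {p q t : ℤ} (h : IsCohTrivial p q t) : rogSign p t = q := by
  rw [isCohTrivial_iff] at h
  unfold rogSign
  split_ifs with h' <;> omega

/-- Under the cohomological-weight condition `q = ±1`. [cite: Rogawski1990, §12.3 p. 178; Prop. 15.2.1 (b)] -/
theorem q_eq_one_or_eq_neg_one_of_isCohTrivial {p q t : ℤ} (h : IsCohTrivial p q t) : q = 1 ∨ q = -1 := by
  rw [isCohTrivial_iff] at h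
  omega

/-- The cohomological-weight condition is conjugation-invariant (`(p, q, t) ↦ (−p, −q, −t−1)`), exchanging the two cases.
[cite: Rogawski1990, §12.3 p. 178] -/
theorem isCohTrivial_conj {p q t : ℤ} (h : IsCohTrivial p q t) : IsCohTrivial (-p) (-q) (-t - 1) := by
  rw [isCohTrivial_iff] at h ⊢
  omega

end ArchSignRecipe

namespace OneDimAutRepH

variable {L : Type} [Field L] [NumberField L] [IsCMField L]

/-- **Rogawski's archimedean label of `ξ` at the embedding `ι`**, for the auxiliary parameter `t` (`μ_ι(z) = (z/z̄)^{t+1/2}`):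
`+1` if `πⁿ(ξ_ι) = J⁺_φ`, `−1` if `πⁿ(ξ_ι) = J⁻_φ` — `ArchSignRecipe.rogSign (ξ.pη ι) t`.  ENGINE documentation API; no statement of
the rung-3 line consumes it (RULING (Q)). [cite: Rogawski1990, §12.3 p. 178] -/
def rogSignAt (ξ : OneDimAutRepH L) (t : ℤ) (ι : L →+* ℂ) : ℤ := ArchSignRecipe.rogSign (ξ.pη ι) t

/-- The label is `±1`. [cite: Rogawski1990, §12.3 p. 178] -/
theorem rogSignAt_eq_one_or_eq_neg_one (ξ : OneDimAutRepH L) (t : ℤ) (ι : L →+* ℂ) :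
    ξ.rogSignAt t ι = 1 ∨ ξ.rogSignAt t ι = -1 :=
  ArchSignRecipe.rogSign_eq_one_or_eq_neg_one _ _

/-- **The label flips under conjugation of the embedding** (with `μ`'s parameter read through `ῑ`, `t ↦ −t−1`): `J⁺_φ ↔ J⁻_φ`.
[cite: Rogawski1990, §12.3 p. 178] -/
theorem rogSignAt_conjugate (ξ : OneDimAutRepH L) (t : ℤ) (ι : L →+* ℂ) :
    ξ.rogSignAt (-t - 1) (ComplexEmbedding.conjugate ι) = -ξ.rogSignAt t ι := by
  unfold rogSignAt
  rw [pη_conjugate, ArchSignRecipe.rogSign_conj]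

/-- `ξ_ι` has COHOMOLOGICAL type for trivial coefficients (w.r.t. `μ`'s parameter `t` at `ι`): `φ(a,b,c) = φ(1,0,−1)`,
i.e. `(q, p + t) ∈ {(1, −2), (−1, 1)}` (`ArchSignRecipe.isCohTrivial_iff`). [cite: Rogawski1990, Prop. 15.2.1 (b); §12.3 p. 178] -/
def IsCohTrivialAt (ξ : OneDimAutRepH L) (t : ℤ) (ι : L →+* ℂ) : Prop := ArchSignRecipe.IsCohTrivial (ξ.pη ι) (ξ.qψ ι) t

/-- **Under the cohomological-weight condition the label is `q = ξ.qψ ι`** (the `ι`-exponent of `ψ`), independent of `η` and `μ`.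
[cite: Rogawski1990, §12.3 p. 178; Prop. 15.2.1 (b)] -/
theorem rogSignAt_eq_qψ (ξ : OneDimAutRepH L) {t : ℤ} {ι : L →+* ℂ} (h : ξ.IsCohTrivialAt t ι) : ξ.rogSignAt t ι = ξ.qψ ι :=
  ArchSignRecipe.rogSign_eq_of_isCohTrivial h

/-- The cohomological-weight condition is invariant under conjugating the embedding (`t ↦ −t−1`).
[cite: Rogawski1990, §12.3 p. 178] -/
theorem isCohTrivialAt_conjugate (ξ : OneDimAutRepH L) {t : ℤ} {ι : L →+* ℂ} (h : ξ.IsCohTrivialAt t ι) :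
    ξ.IsCohTrivialAt (-t - 1) (ComplexEmbedding.conjugate ι) := by
  unfold IsCohTrivialAt
  rw [pη_conjugate, qψ_conjugate]
  exact ArchSignRecipe.isCohTrivial_conj h

end OneDimAutRepH

end Literature.NumberTheory.Rogawski1990

end
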